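import Summits.KontsevichZagierPeriods.KontsevichZagierPeriods.Theses.SymplecticScissors
import Summits.KontsevichZagierPeriods.KontsevichZagierPeriods.Theorems.RealOnePeriodRelations.Negative.Kit
import Summits.KontsevichZagierPeriods.KontsevichZagierPeriods.Theorems.SymplecticScissorsRealOnePeriodRelationsStubSaChart
import Summits.KontsevichZagierPeriods.KontsevichZagierPeriods.Theorems.SymplecticScissorsRealOnePeriodRelationsStubSaPathSubset
import Summits.KontsevichZagierPeriods.KontsevichZagierPeriods.Theorems.SymplecticScissorsRealOnePeriodRelationsStubGreenOnSquare
import Summits.KontsevichZagierPeriods.KontsevichZagierPeriods.Theorems.SymplecticScissorsRealOnePeriodRelationsStubCellGreen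
import Summits.KontsevichZagierPeriods.KontsevichZagierPeriods.Theorems.SymplecticScissorsRealOnePeriodRelationsStubHomotopyInvariance
import Summits.KontsevichZagierPeriods.KontsevichZagierPeriods.Theorems.SymplecticScissorsRealOnePeriodRelationsStubSaHomotopic
import Summits.KontsevichZagierPeriods.KontsevichZagierPeriods.Theorems.SymplecticScissorsRealOnePeriodRelationsStubExactDimOne
import Summits.KontsevichZagierPeriods.KontsevichZagierPeriods.Theorems.SymplecticScissorsRealOnePeriodRelationsStubRealises
import Summits.KontsevichZagierPeriods.KontsevichZagierPeriods.Theorems.SymplecticScissorsRealOnePeriodRelationsStubRetraction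
import Summits.KontsevichZagierPeriods.KontsevichZagierPeriods.Theorems.SymplecticScissorsRealOnePeriodRelationsStubNormalisation
import Literature.NumberTheory.Transcendental.CurvePeriods

/-!
# `RealOnePeriodRelations` from the Huber–Wüstholz theorem for curve-type periods — the line's composition, restated

Line `nash-retraction-thin-strip` of the crux `RealOnePeriodRelations` (stmt-KontsevichZagierPeriods-10042).  The landed
composition `Theorems/SymplecticScissorsRealOnePeriodRelations.lean` states the crux conditionally on the route decl
`Theses.SymplecticScissors.PeriodConjectureCurveType` (item stmt-14055), which the items-cap autofix of 2026-08-16T14:16Z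
DROPPED from the route file (items 14055 and 11129 closed `moot`); that file therefore no longer builds from source and cannot
be mutated (append-only).  This file restates the same composition, with the same proof, against the Literature named fact the
dropped decl abbreviated (`PeriodConjectureCurveType ↔ HuberWustholzCurvePeriods` was `Iff.rfl`):
`realOnePeriodRelations_of_huberWustholzCurvePeriods : HuberWustholzCurvePeriods → RealOnePeriodRelations`, importing only the
stub modules it uses.  Every stub of the line except this apex is a landed theorem; the apex itself is proved in the tree for
genus 0 and for one non-CM elliptic curve, which is what the unconditional layer theorems
`RationalLayer.realOnePeriodRelations_ratLayer` and `EllipticLayer.realOnePeriodRelations_ellLayer` exploit.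
[cite: HuberWustholz2022, Thm 13.3 (2)] [cite: KontsevichZagier2001, §1.2]
-/

noncomputable section

open scoped BigOperators unitInterval
open Set MeasureTheory
open Literature.NumberTheory.Transcendental Literature.NumberTheory.Transcendental.CurvePeriods
open Literature.ModelTheory.ExponentialFields (IsSemialgebraic)
open Summit.KontsevichZagierPeriods.SymplecticScissors.RealOnePeriodRelationsNegative (greenSet M₁ H₁ crux_iff)

namespace Summit.KontsevichZagierPeriods.SymplecticScissors.RealOnePeriodRelations

/-- **`RealOnePeriodRelations` conditionally on the Huber–Wüstholz theorem for curve-type periods** (the line's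
composition, registered as `realOnePeriodRelations_of_huberWustholzCurvePeriods`): if every `ℚ̄`-linear relation among periods
of curve type is a `ℚ̄`-combination of elementary relations (`HuberWustholzCurvePeriods`, Huber–Wüstholz 2022 Thm 13.3 (2);
a named fact, proved in the tree for genus 0 and for one non-CM elliptic curve only), then every `ℤ`-relation among
effective one-dimensional Kontsevich–Zagier periods lies in the subgroup generated by the one-dimensional scissors moves
1a, 1b, 2 and the semialgebraic Green move.  Proof: normalise (`stub_normalisation`), apply the hypothesis to the resulting
curve-type relation, retract with `Θ` (`stub_retraction` and the coherence stubs) — all landed.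
[cite: HuberWustholz2022, Thm 13.3 (2)] [cite: KontsevichZagier2001, §1.2] -/
theorem realOnePeriodRelations_of_huberWustholzCurvePeriods :
    Literature.NumberTheory.Transcendental.HuberWustholzCurvePeriods →
      Summit.KontsevichZagierPeriods.KontsevichZagierPeriods.Theses.SymplecticScissors.RealOnePeriodRelations := by
  intro hHW
  rw [crux_iff]
  intro c hc heval
  obtain ⟨C, R, hCalg, hSA, hReal, hCeval, hcR⟩ := stub_normalisation c hc
  have hC0 : evalCombination C = 0 := by rw [hCeval, heval]; simp
  obtain ⟨k, ρ, a, hρ, ha, hCsum⟩ := hHW C hCalg hC0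
  obtain ⟨Θ, hΘrel, hΘreal⟩ :=
    stub_retraction (stub_saHomotopic stub_saChart (stub_saPathSubset stub_saChart))
      (stub_homotopyInvariance stub_saChart (stub_saPathSubset stub_saChart) (stub_cellGreen stub_greenOnSquare))
      stub_exactDimOne stub_realises
  have h1 : (∑ s ∈ C.support, Θ (C s) s) ∈ M₁ := by
    have h := hΘrel k ρ a hρ ha
    rw [← hCsum] at h
    exact h
  have h2 : (∑ s ∈ C.support, (Θ (C s) s - KZ.of (R s))) ∈ M₁ :=
    sum_mem fun s hs => hΘreal s (C s) (hCalg s) (hSA s hs) (R s) (hReal s hs)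
  have h3 : c = (c - ∑ s ∈ C.support, KZ.of (R s)) - (∑ s ∈ C.support, (Θ (C s) s - KZ.of (R s))) +
      ∑ s ∈ C.support, Θ (C s) s := by
    rw [Finset.sum_sub_distrib]
    abel
  rw [h3]
  exact M₁.add_mem (M₁.sub_mem hcR h2) h1

end Summit.KontsevichZagierPeriods.SymplecticScissors.RealOnePeriodRelations

end
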